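import Mathlib
import Literature.NumberTheory.LFunctions.Zhang2022.Section10RangeToolkit
import Literature.NumberTheory.LFunctions.MertensElementary
import HarnessLib

/-!
# Short-window weighted harmonic sums: `Σ_{Y<n≤X}(n/φ(n))^k/n ≪_k log(X/Y) + (log X)^{2^{k+1}}/Y`

Topic `Literature/NumberTheory/LFunctions/Zhang2022` (Landau–Siegel adjudication tree;
verdict-neutral; campaign siegel-zhang, a generic tool — no DAG node, no claim of the manuscript).
Companion of `Section10RangeToolkit`: its `sum_ratio_pow_div_le` bounds the weighted window sum by
`e^{2^{k+1}}(1 + log X − log Y)`, which does not see the LENGTH of a short window (`X/Y = e^{±𝓛⁻¹⁰}`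
in §12 p. 67, `X/Y = η₊/η₋` in §11, the `𝔱`-windows of (12.6)). This file proves the sharp form
(same elementary method — the expansion `(n/φ(n))^k = Σ_{t⊆{q∣n}}∏a_k(q)`, the swap, multiples of
`∏_{q∈t}q` — with two refinements: the harmonic sum over the multiples of `m` in `(Y, X]` is
`≤ 1/Y + m⁻¹log(X/Y)` (first term + integral comparison), and `∏_{q≤X}(1 + a_k(q)) ≤
exp(2^{k+1}Σ_{q≤X}q⁻¹) ≤ (e⁴ log X)^{2^{k+1}}` by the tree's Mertens bound
`MertensBound.sum_inv_prime_le` [HardyWright2008, Thm 427]):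

* `sum_Ioc_inv_le_inv_add_log` — `Σ_{A<j≤B} j⁻¹ ≤ (A+1)⁻¹ + log B − log(A+1)` (`A < B`);
* `sum_Ioc_filter_dvd_inv_le_window` — `Σ_{Y<n≤X, m∣n} n⁻¹ ≤ Y⁻¹ + m⁻¹(log X − log Y)`;
* `prod_one_add_ratioExcess_le` — `∏_{q≤X prime}(1 + a_k(q)) ≤ exp(4·2^{k+1})(log X)^{2^{k+1}}` (`X ≥ 2`);
* `sum_ratio_pow_div_le_window` — **`Σ_{Y<n≤X}(n/φ(n))^k/n ≤ e^{2^{k+1}}(log X − log Y) +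
  exp(4·2^{k+1})(log X)^{2^{k+1}}/Y`** (`1 ≤ Y ≤ X`, `X ≥ 2`).

For a window of logarithmic length `λ = log(X/Y)` below `X ≤ P` (`log P = 𝓛⁹`) this is
`O_k(λ) + O_k(𝓛^{9·2^{k+1}}/Y)`, the second term being negligible for `Y ≥ P^{0.49}`, say.
[cite: HallTenenbaum1988, §0.2] [cite: HardyWright2008, Thm 427]
-/

noncomputable section

open Real Finset

namespace Literature.NumberTheory.LFunctions.Zhang2022.Skeleton

/-! ## Harmonic sums: first term + integral -/

/-- `Σ_{A<j≤B} j⁻¹ ≤ (A+1)⁻¹ + log B − log(A+1)` for naturals `A < B` (first term, then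
`Σ_{A+1<j≤B} j⁻¹ ≤ ∫_{A+1}^{B} dx/x`). [cite: HallTenenbaum1988, §0.2] -/
theorem sum_Ioc_inv_le_inv_add_log {A B : ℕ} (hAB : A < B) :
    ∑ j ∈ Finset.Ioc A B, (1 / (j : ℝ)) ≤
      1 / ((A : ℝ) + 1) + (Real.log B - Real.log ((A : ℝ) + 1)) := by
  have hA1 : (0 : ℝ) < (A : ℝ) + 1 := by positivity
  have hB0 : (0 : ℝ) < B := by exact_mod_cast lt_of_le_of_lt (Nat.zero_le A) hAB
  -- split off the first term
  have hsplit : Finset.Ioc A B = insert (A + 1) (Finset.Ioc (A + 1) B) := by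
    ext j; simp only [Finset.mem_insert, Finset.mem_Ioc]; omega
  rw [hsplit, Finset.sum_insert (by simp)]
  push_cast
  -- the tail against the integral
  have htail : ∑ j ∈ Finset.Ioc (A + 1) B, (1 / (j : ℝ)) ≤ Real.log B - Real.log ((A : ℝ) + 1) := by
    have hI : Finset.Ioc (A + 1) B = (Finset.Ico (A + 1) B).image (· + 1) := by
      ext j
      simp only [Finset.mem_Ioc, Finset.mem_image, Finset.mem_Ico]
      constructor
      · intro h; exact ⟨j - 1, by omega, by omega⟩
      · rintro ⟨i, hi, rfl⟩; omega
    rw [hI, Finset.sum_image (by intro a _ b _ h; simpa using h)]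
    have hanti : AntitoneOn (fun x : ℝ => 1 / x) (Set.Icc ((A + 1 : ℕ) : ℝ) (B : ℝ)) := by
      intro x hx y hy hxy
      have hx0 : 0 < x := lt_of_lt_of_le (by push_cast; positivity) hx.1
      exact one_div_le_one_div_of_le hx0 hxy
    have h := AntitoneOn.sum_le_integral_Ico (Nat.succ_le_of_lt hAB) hanti
    have hint : ∫ x in ((A + 1 : ℕ) : ℝ)..(B : ℝ), (1 / x) = Real.log B - Real.log ((A : ℝ) + 1) := by
      push_cast
      rw [integral_one_div_of_pos hA1 hB0, Real.log_div hB0.ne' hA1.ne']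
    calc ∑ x ∈ Finset.Ico (A + 1) B, (1 / (((x + 1 : ℕ) : ℝ)))
        = ∑ i ∈ Finset.Ico (A + 1) B, (1 / ((i : ℝ) + 1)) := by
          refine Finset.sum_congr rfl fun i _ => by push_cast; ring
      _ ≤ ∫ x in ((A + 1 : ℕ) : ℝ)..(B : ℝ), (1 / x) := by
          convert h using 2 with i
          push_cast; ring
      _ = Real.log B - Real.log ((A : ℝ) + 1) := hint
  linarith

/-- **The window harmonic sum over the multiples of `m`, sharp in the window**:
`Σ_{Y<n≤X, m∣n} n⁻¹ ≤ Y⁻¹ + m⁻¹(log X − log Y)` (`1 ≤ Y ≤ X`, `m ≥ 1`; compare the crude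
`m⁻¹(1 + log X − log Y)` of `sum_Ioc_filter_dvd_inv_le`). [cite: HallTenenbaum1988, §0.2] -/
theorem sum_Ioc_filter_dvd_inv_le_window {m Y X : ℕ} (hm : 0 < m) (hY : 0 < Y) (hYX : Y ≤ X) :
    ∑ n ∈ (Finset.Ioc Y X).filter (fun n => m ∣ n), (1 / (n : ℝ)) ≤
      1 / (Y : ℝ) + (1 / (m : ℝ)) * (Real.log X - Real.log Y) := by
  classical
  have hm0 : (0 : ℝ) < m := by exact_mod_cast hm
  have hY0 : (0 : ℝ) < Y := by exact_mod_cast hY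
  have hX0 : (0 : ℝ) < X := by exact_mod_cast lt_of_lt_of_le hY hYX
  have hlogYX : Real.log Y ≤ Real.log X := Real.log_le_log hY0 (by exact_mod_cast hYX)
  -- the multiples of `m` in `(Y, X]` are `m·j`, `Y/m < j ≤ X/m`
  set A : ℕ := Y / m with hA
  set B : ℕ := X / m with hB
  have hset : (Finset.Ioc Y X).filter (fun n => m ∣ n) = (Finset.Ioc A B).image (fun j => m * j) := by
    ext n
    simp only [Finset.mem_filter, Finset.mem_Ioc, Finset.mem_image]
    constructor
    · rintro ⟨⟨h1, h2⟩, ⟨j, rfl⟩⟩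
      refine ⟨j, ⟨?_, ?_⟩, rfl⟩
      · rw [hA, Nat.div_lt_iff_lt_mul hm, Nat.mul_comm]; exact h1
      · rw [hB, Nat.le_div_iff_mul_le hm, Nat.mul_comm]; exact h2
    · rintro ⟨j, ⟨h1, h2⟩, rfl⟩
      refine ⟨⟨?_, ?_⟩, dvd_mul_right m j⟩
      · rw [hA, Nat.div_lt_iff_lt_mul hm, Nat.mul_comm] at h1; exact h1
      · rw [hB, Nat.le_div_iff_mul_le hm, Nat.mul_comm] at h2; exact h2
  rw [hset, Finset.sum_image (by intro a _ b _ h; exact Nat.eq_of_mul_eq_mul_left hm h)]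
  have hresc : ∑ j ∈ Finset.Ioc A B, (1 / (((m * j : ℕ) : ℝ))) =
      (1 / (m : ℝ)) * ∑ j ∈ Finset.Ioc A B, (1 / (j : ℝ)) := by
    rw [Finset.mul_sum]
    refine Finset.sum_congr rfl fun j _ => ?_
    push_cast
    rw [one_div_mul_one_div]
  rw [hresc]
  rcases lt_or_ge A B with hAB | hBA
  · have h := sum_Ioc_inv_le_inv_add_log hAB
    -- `Y/m < A + 1`, `1 ≤ B ≤ X/m`
    have hA1 : (Y : ℝ) / m < (A : ℝ) + 1 := by
      rw [div_lt_iff₀ hm0]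
      have h1 : Y < Y / m * m + m := Nat.lt_div_mul_add hm
      have h2 : ((Y : ℕ) : ℝ) < ((Y / m * m + m : ℕ) : ℝ) := by exact_mod_cast h1
      push_cast at h2
      rw [hA]; linarith
    have hA1pos : (0 : ℝ) < (A : ℝ) + 1 := by positivity
    have hYm : 0 < (Y : ℝ) / m := div_pos hY0 hm0
    have hBle : (B : ℝ) ≤ (X : ℝ) / m := by rw [hB]; exact Nat.cast_div_le
    have hB0 : (0 : ℝ) < B := by exact_mod_cast lt_of_le_of_lt (Nat.zero_le A) hAB
    have hfirst : 1 / ((A : ℝ) + 1) ≤ (m : ℝ) / Y := by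
      rw [show (m : ℝ) / Y = 1 / ((Y : ℝ) / m) by field_simp]
      exact one_div_le_one_div_of_le hYm hA1.le
    have hlogB : Real.log B ≤ Real.log X - Real.log m := by
      rw [← Real.log_div hX0.ne' hm0.ne']; exact Real.log_le_log hB0 hBle
    have hlogA : Real.log Y - Real.log m ≤ Real.log ((A : ℝ) + 1) := by
      rw [← Real.log_div hY0.ne' hm0.ne']; exact Real.log_le_log hYm hA1.le
    calc (1 / (m : ℝ)) * ∑ j ∈ Finset.Ioc A B, (1 / (j : ℝ))
        ≤ (1 / (m : ℝ)) * (1 / ((A : ℝ) + 1) + (Real.log B - Real.log ((A : ℝ) + 1))) :=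
          mul_le_mul_of_nonneg_left h (by positivity)
      _ ≤ (1 / (m : ℝ)) * ((m : ℝ) / Y + (Real.log X - Real.log Y)) :=
          mul_le_mul_of_nonneg_left (by linarith) (by positivity)
      _ = 1 / (Y : ℝ) + (1 / (m : ℝ)) * (Real.log X - Real.log Y) := by
          field_simp
  · rw [Finset.Ioc_eq_empty (by omega), Finset.sum_empty, mul_zero]
    have : 0 ≤ (1 / (m : ℝ)) * (Real.log X - Real.log Y) := by positivity
    linarith [one_div_pos.mpr hY0]

/-! ## The Euler product `∏_{q≤X}(1 + a_k(q))` via Mertens -/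

/-- `∏_{q≤X prime}(1 + a_k(q)) ≤ exp(4·2^{k+1})·(log X)^{2^{k+1}}` for `X ≥ 2`, where
`a_k(q) = (q/(q−1))^k − 1 ≤ 2^{k+1}/q` (`ratio_pow_sub_one_bounds`) and `Σ_{q≤X} q⁻¹ ≤ log log X + 4`
(`MertensBound.sum_inv_prime_le`). [cite: HardyWright2008, Thm 427] -/
theorem prod_one_add_ratioExcess_le (k : ℕ) {X : ℕ} (hX : 2 ≤ X) :
    ∏ q ∈ (Finset.Icc 1 X).filter Nat.Prime, (1 + (((q : ℝ) / (q - 1)) ^ k - 1)) ≤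
      Real.exp (4 * 2 ^ (k + 1)) * Real.log X ^ (2 ^ (k + 1)) := by
  set PB : Finset ℕ := (Finset.Icc 1 X).filter Nat.Prime with hPB
  set a : ℕ → ℝ := fun q => ((q : ℝ) / (q - 1)) ^ k - 1 with ha
  have hq2 : ∀ q ∈ PB, (2 : ℕ) ≤ q := fun q hq => (Finset.mem_filter.mp hq).2.two_le
  have ha0 : ∀ q ∈ PB, 0 ≤ a q := fun q hq => (ratio_pow_sub_one_bounds k (hq2 q hq)).1
  have hX0 : (0 : ℝ) < X := by exact_mod_cast lt_of_lt_of_le (by norm_num) hX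
  have hlogX : 0 < Real.log X := Real.log_pos (by exact_mod_cast lt_of_lt_of_le (by norm_num) hX)
  -- `∏(1 + a) ≤ exp(Σ a)`
  have h1 : ∏ q ∈ PB, (1 + a q) ≤ Real.exp (∑ q ∈ PB, a q) := by
    rw [Real.exp_sum]
    refine Finset.prod_le_prod (fun q hq => by linarith [ha0 q hq]) fun q hq => ?_
    linarith [Real.add_one_le_exp (a q)]
  -- `Σ a ≤ 2^{k+1} Σ 1/q ≤ 2^{k+1}(log log X + 4)`
  have h2 : ∑ q ∈ PB, a q ≤ 2 ^ (k + 1) * (Real.log (Real.log X) + 4) := by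
    have hsub : PB ⊆ Nat.primesLE X := by
      intro q hq
      rw [hPB, Finset.mem_filter, Finset.mem_Icc] at hq
      exact Nat.mem_primesLE.mpr ⟨hq.1.2, hq.2⟩
    calc ∑ q ∈ PB, a q ≤ ∑ q ∈ PB, (2 : ℝ) ^ (k + 1) * (1 / (q : ℝ)) := by
          refine Finset.sum_le_sum fun q hq => ?_
          rw [mul_one_div]; exact (ratio_pow_sub_one_bounds k (hq2 q hq)).2
      _ = 2 ^ (k + 1) * ∑ q ∈ PB, (1 / (q : ℝ)) := by rw [Finset.mul_sum]
      _ ≤ 2 ^ (k + 1) * ∑ q ∈ Nat.primesLE X, (1 / (q : ℝ)) :=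
          mul_le_mul_of_nonneg_left
            (Finset.sum_le_sum_of_subset_of_nonneg hsub fun q _ _ => by positivity)
            (by positivity)
      _ ≤ 2 ^ (k + 1) * (Real.log (Real.log X) + 4) := by
          gcongr; exact MertensBound.sum_inv_prime_le X hX
  calc ∏ q ∈ PB, (1 + a q) ≤ Real.exp (∑ q ∈ PB, a q) := h1
    _ ≤ Real.exp (2 ^ (k + 1) * (Real.log (Real.log X) + 4)) := Real.exp_le_exp.mpr h2
    _ = Real.exp (4 * 2 ^ (k + 1)) * Real.log X ^ (2 ^ (k + 1)) := by
        rw [show (2 : ℝ) ^ (k + 1) * (Real.log (Real.log X) + 4) =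
          4 * 2 ^ (k + 1) + ((2 ^ (k + 1) : ℕ) : ℝ) * Real.log (Real.log X) by push_cast; ring,
          Real.exp_add, Real.exp_nat_mul, Real.exp_log hlogX]

/-! ## The sharp window bound -/

/-- **Short-window weighted harmonic sum**: for `k ∈ ℕ`, `1 ≤ Y ≤ X`, `X ≥ 2`,
`Σ_{Y<n≤X} (n/φ(n))^k/n ≤ e^{2^{k+1}}(log X − log Y) + exp(4·2^{k+1})(log X)^{2^{k+1}}/Y` —
the window length `log(X/Y)` is kept (no `+1`), at the price of the boundary term
`O_k((log X)^{2^{k+1}}/Y)`, negligible for `Y` a power of `P`. Same expansion as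
`sum_ratio_pow_div_le`, with `sum_Ioc_filter_dvd_inv_le_window` and `prod_one_add_ratioExcess_le`.
[cite: HallTenenbaum1988, §0.2] -/
theorem sum_ratio_pow_div_le_window (k : ℕ) {Y X : ℕ} (hY : 0 < Y) (hYX : Y ≤ X) (hX : 2 ≤ X) :
    ∑ n ∈ Finset.Ioc Y X, ((n : ℝ) / Nat.totient n) ^ k / n ≤
      Real.exp (2 ^ (k + 1)) * (Real.log X - Real.log Y) +
        Real.exp (4 * 2 ^ (k + 1)) * Real.log X ^ (2 ^ (k + 1)) / Y := by
  classical
  set a : ℕ → ℝ := fun q => ((q : ℝ) / (q - 1)) ^ k - 1 with ha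
  set Lw : ℝ := Real.log X - Real.log Y with hLw
  set PB : Finset ℕ := (Finset.Icc 1 X).filter Nat.Prime with hPB
  have hY0 : (0 : ℝ) < Y := by exact_mod_cast hY
  have hLw0 : 0 ≤ Lw := by
    have : Real.log Y ≤ Real.log X := Real.log_le_log hY0 (by exact_mod_cast hYX)
    rw [hLw]; linarith
  have ha0 : ∀ q, q.Prime → 0 ≤ a q := fun q hq => (ratio_pow_sub_one_bounds k hq.two_le).1
  -- (1) expand and swap (as in `sum_ratio_pow_div_le`)
  have step1 : ∑ n ∈ Finset.Ioc Y X, ((n : ℝ) / Nat.totient n) ^ k / n =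
      ∑ n ∈ Finset.Ioc Y X, ∑ t ∈ n.primeFactors.powerset, (∏ q ∈ t, a q) / n := by
    refine Finset.sum_congr rfl fun n hn => ?_
    have hn0 : n ≠ 0 := by
      have := (Finset.mem_Ioc.mp hn).1; omega
    rw [ratio_pow_eq_sum_powerset k hn0, Finset.sum_div]
  have step2 : ∑ n ∈ Finset.Ioc Y X, ∑ t ∈ n.primeFactors.powerset, (∏ q ∈ t, a q) / n =
      ∑ t ∈ PB.powerset, ∑ n ∈ (Finset.Ioc Y X).filter (fun n => t ⊆ n.primeFactors),
        (∏ q ∈ t, a q) / n := by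
    refine Finset.sum_comm' fun n t => ?_
    simp only [Finset.mem_powerset, Finset.mem_filter, Finset.mem_Ioc]
    constructor
    · rintro ⟨hn, ht⟩
      refine ⟨⟨hn, ht⟩, ?_⟩
      intro q hq
      have hq' := ht hq
      rw [hPB, Finset.mem_filter, Finset.mem_Icc]
      have hqp := Nat.prime_of_mem_primeFactors hq'
      have hn0 : n ≠ 0 := by omega
      exact ⟨⟨hqp.one_le, le_trans (Nat.le_of_dvd (Nat.pos_of_ne_zero hn0)
        (Nat.dvd_of_mem_primeFactors hq')) hn.2⟩, hqp⟩
    · rintro ⟨⟨hn, ht⟩, -⟩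
      exact ⟨hn, ht⟩
  -- (2) the inner sums, with the sharp multiples bound
  have inner : ∀ t ∈ PB.powerset,
      ∑ n ∈ (Finset.Ioc Y X).filter (fun n => t ⊆ n.primeFactors), (∏ q ∈ t, a q) / n ≤
        (∏ q ∈ t, a q) * (1 / (Y : ℝ)) + (∏ q ∈ t, a q / q) * Lw := by
    intro t ht
    rw [Finset.mem_powerset] at ht
    have htp : ∀ q ∈ t, q.Prime := fun q hq => (Finset.mem_filter.mp (ht hq)).2
    have hprod0 : 0 ≤ ∏ q ∈ t, a q := Finset.prod_nonneg fun q hq => ha0 q (htp q hq)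
    set m : ℕ := ∏ q ∈ t, q with hm
    have hm0 : 0 < m := Finset.prod_pos fun q hq => (htp q hq).pos
    have hsub : (Finset.Ioc Y X).filter (fun n => t ⊆ n.primeFactors) ⊆
        (Finset.Ioc Y X).filter (fun n => m ∣ n) := by
      intro n hn
      rw [Finset.mem_filter] at hn ⊢
      refine ⟨hn.1, ?_⟩
      exact (Finset.prod_dvd_prod_of_subset _ _ (fun q => q) hn.2).trans
        (Nat.prod_primeFactors_dvd n)
    calc ∑ n ∈ (Finset.Ioc Y X).filter (fun n => t ⊆ n.primeFactors), (∏ q ∈ t, a q) / n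
        ≤ ∑ n ∈ (Finset.Ioc Y X).filter (fun n => m ∣ n), (∏ q ∈ t, a q) / n :=
          Finset.sum_le_sum_of_subset_of_nonneg hsub fun n _ _ => by positivity
      _ = (∏ q ∈ t, a q) * ∑ n ∈ (Finset.Ioc Y X).filter (fun n => m ∣ n), (1 / (n : ℝ)) := by
          rw [Finset.mul_sum]
          refine Finset.sum_congr rfl fun n _ => by rw [mul_one_div]
      _ ≤ (∏ q ∈ t, a q) * (1 / (Y : ℝ) + (1 / (m : ℝ)) * Lw) :=
          mul_le_mul_of_nonneg_left (sum_Ioc_filter_dvd_inv_le_window hm0 hY hYX) hprod0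
      _ = (∏ q ∈ t, a q) * (1 / (Y : ℝ)) + (∏ q ∈ t, a q / q) * Lw := by
          rw [hm, Nat.cast_prod, Finset.prod_div_distrib]
          ring
  -- (3) the two Euler products
  have step3 : ∑ t ∈ PB.powerset, ((∏ q ∈ t, a q) * (1 / (Y : ℝ)) + (∏ q ∈ t, a q / q) * Lw) =
      (∏ q ∈ PB, (1 + a q)) * (1 / (Y : ℝ)) + (∏ q ∈ PB, (1 + a q / q)) * Lw := by
    rw [Finset.sum_add_distrib, ← Finset.sum_mul, ← Finset.sum_mul, Finset.prod_one_add,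
      Finset.prod_one_add]
  have step4 : ∏ q ∈ PB, (1 + a q / q) ≤ Real.exp (2 ^ (k + 1)) := by
    have hq2 : ∀ q ∈ PB, (2 : ℕ) ≤ q := fun q hq => (Finset.mem_filter.mp hq).2.two_le
    have h1 : ∏ q ∈ PB, (1 + a q / q) ≤ ∏ q ∈ PB, Real.exp (a q / q) := by
      refine Finset.prod_le_prod (fun q hq => ?_) fun q hq => ?_
      · have := ha0 q (Finset.mem_filter.mp hq).2
        positivity
      · have := Real.add_one_le_exp (a q / q)
        linarith
    refine h1.trans ?_
    rw [← Real.exp_sum]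
    refine Real.exp_le_exp.mpr ?_
    have h2 : ∑ q ∈ PB, a q / q ≤ ∑ q ∈ PB, (2 : ℝ) ^ (k + 1) * ((q : ℝ) ^ 2)⁻¹ := by
      refine Finset.sum_le_sum fun q hq => ?_
      have hq := hq2 q hq
      have hqr : (0 : ℝ) < q := by exact_mod_cast lt_of_lt_of_le (by norm_num) hq
      have hb := (ratio_pow_sub_one_bounds k hq).2
      calc a q / q ≤ (2 ^ (k + 1) / q) / q := by gcongr
        _ = 2 ^ (k + 1) * ((q : ℝ) ^ 2)⁻¹ := by field_simp
    refine h2.trans ?_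
    rw [← Finset.mul_sum]
    have h3 : ∑ q ∈ PB, ((q : ℝ) ^ 2)⁻¹ ≤ 1 := by
      have hsub : PB ⊆ Finset.Ioo 1 (X + 1) := by
        intro q hq
        rw [hPB, Finset.mem_filter, Finset.mem_Icc] at hq
        rw [Finset.mem_Ioo]
        exact ⟨hq.2.one_lt, Nat.lt_succ_of_le hq.1.2⟩
      calc ∑ q ∈ PB, ((q : ℝ) ^ 2)⁻¹ ≤ ∑ q ∈ Finset.Ioo 1 (X + 1), ((q : ℝ) ^ 2)⁻¹ :=
            Finset.sum_le_sum_of_subset_of_nonneg hsub fun q _ _ => by positivity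
        _ ≤ 2 / (((1 : ℕ) : ℝ) + 1) := sum_Ioo_inv_sq_le 1 (X + 1)
        _ = 1 := by norm_num
    calc (2 : ℝ) ^ (k + 1) * ∑ q ∈ PB, ((q : ℝ) ^ 2)⁻¹ ≤ 2 ^ (k + 1) * 1 := by gcongr
      _ = 2 ^ (k + 1) := mul_one _
  have step5 : ∏ q ∈ PB, (1 + a q) ≤ Real.exp (4 * 2 ^ (k + 1)) * Real.log X ^ (2 ^ (k + 1)) :=
    prod_one_add_ratioExcess_le k hX
  have hprod0 : 0 ≤ ∏ q ∈ PB, (1 + a q) :=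
    Finset.prod_nonneg fun q hq => by linarith [ha0 q (Finset.mem_filter.mp hq).2]
  -- assemble
  rw [step1, step2]
  calc ∑ t ∈ PB.powerset, ∑ n ∈ (Finset.Ioc Y X).filter (fun n => t ⊆ n.primeFactors),
          (∏ q ∈ t, a q) / n
      ≤ ∑ t ∈ PB.powerset, ((∏ q ∈ t, a q) * (1 / (Y : ℝ)) + (∏ q ∈ t, a q / q) * Lw) :=
        Finset.sum_le_sum inner
    _ = (∏ q ∈ PB, (1 + a q)) * (1 / (Y : ℝ)) + (∏ q ∈ PB, (1 + a q / q)) * Lw := step3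
    _ ≤ (Real.exp (4 * 2 ^ (k + 1)) * Real.log X ^ (2 ^ (k + 1))) * (1 / (Y : ℝ)) +
          Real.exp (2 ^ (k + 1)) * Lw := by
        gcongr
    _ = Real.exp (2 ^ (k + 1)) * (Real.log X - Real.log Y) +
          Real.exp (4 * 2 ^ (k + 1)) * Real.log X ^ (2 ^ (k + 1)) / Y := by
        rw [hLw]; ring

end Literature.NumberTheory.LFunctions.Zhang2022.Skeleton

end
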